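import Mathlib

/-!
# `Capture` (stmt-PneNP-2659, route PneNP/ConvexRankGates) — negative-side lemmas: Boolean transitive closure by relaxation

Helper for `PermConstraintsCircuit.lean` (cdisprove, gen 3 / cycle 3): `relax e t p q` — `t` rounds of
Bellman–Ford relaxation of a Boolean edge relation from the diagonal — and `relax_card_iff`: **`card α`
rounds compute reflexive–transitive reachability** (the reached set grows strictly until it stabilises;
`reached_card_stable`), monotone in the edges (`relax_mono_edges`). This is the shape in which STCONN enters
monotone `{∧₂,∨₂}`-circuits via `CktSize.iterate`.

Refuter seat cdisprove-stmt-PneNP-2659-g3, 2026-08-16. Crux work file: `Cruxes/Capture/Disproof.lean` §17.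
-/

set_option linter.dupNamespace false -- `Summit.PneNP.PneNP.…`: summit = sub-problem (D-0017)

namespace Summit.PneNP.PneNP.Theorems.Capture.Negative

section Relax

variable {α : Type*} [Fintype α] [DecidableEq α]

/-- `t` rounds of Bellman–Ford relaxation of the Boolean edge relation `e` from the diagonal:
`relax e t p q = true` iff `q` is reachable from `p` by at most `t` edges. [folklore] -/
def relax (e : α → α → Bool) : ℕ → α → α → Bool
  | 0, p, q => decide (p = q)
  | t + 1, p, q => relax e t p q || decide (∃ u, relax e t p u = true ∧ e u q = true)

omit [DecidableEq α] in
/-- The edge relation as a `Prop`. [folklore] -/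
def edgeRel (e : α → α → Bool) (a b : α) : Prop := e a b = true

/-- Relaxation only finds reachable points. [folklore] -/
theorem reflTransGen_of_relax (e : α → α → Bool) :
    ∀ (t : ℕ) (p q : α), relax e t p q = true → Relation.ReflTransGen (edgeRel e) p q
  | 0, p, q, h => by
    simp only [relax, decide_eq_true_eq] at h
    subst h
    exact Relation.ReflTransGen.refl
  | t + 1, p, q, h => by
    simp only [relax, Bool.or_eq_true, decide_eq_true_eq] at h
    rcases h with h | ⟨u, hu, he⟩
    · exact reflTransGen_of_relax e t p q h
    · exact (reflTransGen_of_relax e t p u hu).tail he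

/-- Relaxation is inflationary in `t`. [folklore] -/
theorem relax_mono_succ (e : α → α → Bool) (t : ℕ) (p q : α) (h : relax e t p q = true) :
    relax e (t + 1) p q = true := by
  simp only [relax, Bool.or_eq_true]
  exact Or.inl h

/-- The set reached from `p` after `t` rounds. [folklore] -/
def reached (e : α → α → Bool) (t : ℕ) (p : α) : Finset α := Finset.univ.filter fun q => relax e t p q = true

/-- The reached sets increase. [folklore] -/
theorem reached_subset_succ (e : α → α → Bool) (t : ℕ) (p : α) : reached e t p ⊆ reached e (t + 1) p := by
  intro q hq
  simp only [reached, Finset.mem_filter, Finset.mem_univ, true_and] at hq ⊢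
  exact relax_mono_succ e t p q hq

/-- One round is a function of the previous reached set: equal sets stay equal. [folklore] -/
theorem reached_succ_eq_of_eq (e : α → α → Bool) {t t' : ℕ} (p : α)
    (h : reached e t p = reached e t' p) : reached e (t + 1) p = reached e (t' + 1) p := by
  have hpt : ∀ q, relax e t p q = relax e t' p q := fun q => by
    have := congrArg (q ∈ ·) h
    simp only [reached, Finset.mem_filter, Finset.mem_univ, true_and, eq_iff_iff] at this
    rw [Bool.eq_iff_iff, this]
  ext q
  simp only [reached, Finset.mem_filter, Finset.mem_univ, true_and, relax, hpt]

/-- A stable round stays stable. [folklore] -/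
theorem reached_stable (e : α → α → Bool) {t : ℕ} (p : α) (h : reached e t p = reached e (t + 1) p) :
    ∀ k, reached e (t + k) p = reached e t p
  | 0 => rfl
  | k + 1 => by
    have ih := reached_stable e p h k
    rw [← add_assoc, reached_succ_eq_of_eq e p ih, ← h]

/-- Within `card α` rounds the reached set stabilises (it grows strictly until it does, from size `1`).
[folklore] -/
theorem reached_card_stable (e : α → α → Bool) (p : α) :
    reached e (Fintype.card α) p = reached e (Fintype.card α + 1) p := by
  by_contra hne
  -- if the `card α`-th round is unstable, all earlier rounds are unstable, so sizes grow by one each round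
  have hunstable : ∀ t ≤ Fintype.card α, reached e t p ≠ reached e (t + 1) p := by
    intro t ht heq
    have := reached_stable e p heq (Fintype.card α - t)
    have h2 := reached_stable e p heq (Fintype.card α - t + 1)
    rw [show t + (Fintype.card α - t) = Fintype.card α by omega] at this
    rw [show t + (Fintype.card α - t + 1) = Fintype.card α + 1 by omega] at h2
    exact hne (this.trans h2.symm)
  have hgrow : ∀ t ≤ Fintype.card α + 1, t + 1 ≤ (reached e t p).card := by
    intro t
    induction t with
    | zero =>
      intro _
      refine Finset.card_pos.2 ⟨p, ?_⟩
      simp [reached, relax]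
    | succ t ih =>
      intro ht
      have h1 := ih (by omega)
      have hss : reached e t p ⊂ reached e (t + 1) p :=
        Finset.ssubset_iff_subset_ne.2 ⟨reached_subset_succ e t p, hunstable t (by omega)⟩
      have := Finset.card_lt_card hss
      omega
  have := hgrow (Fintype.card α + 1) le_rfl
  have hle : (reached e (Fintype.card α + 1) p).card ≤ Fintype.card α := Finset.card_le_univ _
  omega

/-- **`card α` rounds of relaxation compute reachability.** [folklore] -/
theorem relax_card_iff (e : α → α → Bool) (p q : α) :
    relax e (Fintype.card α) p q = true ↔ Relation.ReflTransGen (edgeRel e) p q := by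
  refine ⟨reflTransGen_of_relax e _ p q, fun h => ?_⟩
  -- the stable set contains `p` and is closed under edges
  have hstab := reached_card_stable e p
  set T := Fintype.card α with hT
  have hp : relax e T p p = true := by
    have h0 : relax e 0 p p = true := by simp [relax]
    have : ∀ t, relax e t p p = true := fun t => by
      induction t with
      | zero => exact h0
      | succ t ih => exact relax_mono_succ e t p p ih
    exact this T
  have hclosed : ∀ u w, relax e T p u = true → e u w = true → relax e T p w = true := by
    intro u w hu huw
    have hw : relax e (T + 1) p w = true := by
      simp only [relax, Bool.or_eq_true, decide_eq_true_eq]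
      exact Or.inr ⟨u, hu, huw⟩
    have : w ∈ reached e (T + 1) p := by simpa [reached] using hw
    rw [← hstab] at this
    simpa [reached] using this
  induction h with
  | refl => exact hp
  | tail _ huw ih => exact hclosed _ _ ih huw

/-- Relaxation is monotone in the edge relation. [folklore] -/
theorem relax_mono_edges {e e' : α → α → Bool} (hee' : ∀ a b, e a b = true → e' a b = true) :
    ∀ (t : ℕ) (p q : α), relax e t p q = true → relax e' t p q = true
  | 0, p, q, h => h
  | t + 1, p, q, h => by
    simp only [relax, Bool.or_eq_true, decide_eq_true_eq] at h ⊢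
    rcases h with h | ⟨u, hu, huq⟩
    · exact Or.inl (relax_mono_edges hee' t p q h)
    · exact Or.inr ⟨u, relax_mono_edges hee' t p u hu, hee' u q huq⟩

end Relax

end Summit.PneNP.PneNP.Theorems.Capture.Negative
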